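import Literature.NumberTheory.Transcendental.PhilipponZeroEstimateMultidegree
import Literature.NumberTheory.Transcendental.GaGmZariski
import HarnessLib

/-!
# Nesterenko 2003, Prop. 5.1 — the degenerate cases (`D₀ = 0` or some `Dⱼ = 0`)

Topic `Literature/NumberTheory/Transcendental`. The named fact
`Literature.NumberTheory.Transcendental.Nesterenko2003_prop51` (`PhilipponZeroEstimateMultidegree.lean`;
Nesterenko 2003, LNM 1819, §5.1, Prop. 5.1) allows the degrees `D₀, D₁, …, Dₙ` to be `0`, where
its right-hand side `(n+1)!·2ⁿ·D₀·D₁⋯Dₙ` vanishes and the conclusion holds for a trivial reason: an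
algebraic subgroup `G*` of dimension `≤ n` whose obstruction polynomial (5.7)
`𝓗(G*; D₀, D₁, …, Dₙ)` (`GaGm.nesterenkoH`) is `0` — the full torus `{0} × 𝔾ₘⁿ` if some `Dⱼ = 0`
(the only term of the minors sum is `D₁⋯Dₙ = 0`), resp. `𝔾ₐ × T_{ℤe₁}` if `D₀ = 0` (factor
`D₀^{d₀} = 0^1`); for `n = 0`, `D₀ = 0` the hypotheses are contradictory (`Q` is a non-zero constant
vanishing at `e`). This file PROVES these cases (`GaGm.nesterenko2003_prop51_of_D_eq_zero`,
`GaGm.nesterenko2003_prop51_of_D₀_eq_zero`), with the conclusion literally that of the named fact,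
so that the discharge `Nesterenko2003_prop51_holds` only has to treat `D₀, Dⱼ ≥ 1`.

## References

* Yu. V. Nesterenko, *Linear forms in logarithms of rational numbers*, LNM 1819 (2003), §5.1,
  (5.7) and Prop. 5.1. [Nesterenko2003]
-/

noncomputable section

open Module Finset MvPolynomial

namespace Literature.NumberTheory.Transcendental

namespace GaGm

variable {n : ℕ}

/-! ### Vanishing of the obstruction polynomial -/

/-- For the full torus (`r = 0`, `d₀ = 0`) the obstruction polynomial is `n!·2ⁿ·D₁⋯Dₙ`, which
vanishes as soon as some `Dⱼ = 0`. [cite: Nesterenko2003, §5.1 (5.7)] -/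
theorem nesterenkoH_zero_rank_eq_zero (M : Matrix (Fin 0) (Fin n) ℤ) (D₀ : ℕ) {D : Fin n → ℕ}
    (hD : ∃ j, D j = 0) : nesterenkoH n 0 0 M D₀ D = 0 := by
  obtain ⟨j, hj⟩ := hD
  rw [nesterenkoH, Finset.powersetCard_zero, Finset.sum_singleton, Finset.sdiff_empty,
    Finset.prod_eq_zero (Finset.mem_univ j) hj, mul_zero, mul_zero]

/-- With additive part (`d₀ = 1`) and `D₀ = 0` the obstruction polynomial vanishes (factor
`D₀^{d₀} = 0`). [cite: Nesterenko2003, §5.1 (5.7)] -/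
theorem nesterenkoH_addDim_one_D₀_zero {r : ℕ} (M : Matrix (Fin r) (Fin n) ℤ) (D : Fin n → ℕ) :
    nesterenkoH n r 1 M 0 D = 0 := by
  rw [nesterenkoH, pow_one, mul_zero, zero_mul]

/-! ### The subgroups used -/

/-- The trivial character lattice `0 ≤ ℤⁿ` is saturated. [cite: Nesterenko2003, §5.1] -/
theorem saturated_bot (k : ℤ) (χ : Fin n → ℤ) (hk : k ≠ 0) (h : k • χ ∈ (⊥ : AddSubgroup (Fin n → ℤ))) :
    χ ∈ (⊥ : AddSubgroup (Fin n → ℤ)) := by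
  rw [AddSubgroup.mem_bot] at h ⊢
  exact (smul_eq_zero.mp h).resolve_left hk

/-- The cyclic lattice `ℤ·e_j ≤ ℤⁿ` of a unit vector is saturated. [cite: Nesterenko2003, §5.1] -/
theorem saturated_zmultiples_single (j₀ : Fin n) (k : ℤ) (χ : Fin n → ℤ) (hk : k ≠ 0)
    (h : k • χ ∈ AddSubgroup.zmultiples (Pi.single j₀ (1 : ℤ) : Fin n → ℤ)) :
    χ ∈ AddSubgroup.zmultiples (Pi.single j₀ (1 : ℤ) : Fin n → ℤ) := by
  rw [AddSubgroup.mem_zmultiples_iff] at h ⊢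
  obtain ⟨m, hm⟩ := h
  refine ⟨χ j₀, funext fun j => ?_⟩
  have hj := congrFun hm j
  simp only [Pi.smul_apply, smul_eq_mul, Pi.single_apply] at hj ⊢
  by_cases hjj : j = j₀
  · subst hjj; simp
  · rw [if_neg hjj, mul_zero] at hj ⊢
    exact ((mul_eq_zero.mp hj.symm).resolve_left hk).symm

/-! ### The degenerate cases of Prop. 5.1 -/

/-- **Prop. 5.1 when some `Dⱼ = 0`**: the right-hand side is `0`, and the full torus
`G* = {0} × 𝔾ₘⁿ` (`d₀ = 0`, `r = 0`) has `𝓗(G*; D) = n!·2ⁿ·D₁⋯Dₙ = 0`. [cite: Nesterenko2003, Prop 5.1] -/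
theorem nesterenko2003_prop51_of_D_eq_zero (D₀ S₀ : ℕ) {D : Fin n → ℕ} (hD : ∃ j, D j = 0)
    (W : Submodule ℂ (ℂ × (Fin n → ℂ))) (S : Set (GaGm n)) :
    ∃ (H : ConnAlgSubgroup n) (r : ℕ) (M : Matrix (Fin r) (Fin n) ℤ),
      LinearIndependent ℤ (fun i => M i) ∧
      H.chars = AddSubgroup.closure (Set.range fun i => M i) ∧
      H.addDim + (n - r) ≤ n ∧
      Nat.choose (S₀ + (Module.finrank ℂ W - Module.finrank ℂ ↥(W ⊓ H.tangent)))
          (Module.finrank ℂ W - Module.finrank ℂ ↥(W ⊓ H.tangent)) *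
        Set.ncard ((QuotientGroup.mk : GaGm n → GaGm n ⧸ H.toSubgroup) '' S) *
        nesterenkoH n r H.addDim M D₀ D ≤ (n + 1).factorial * 2 ^ n * D₀ * ∏ j, D j := by
  refine ⟨⟨false, ⊥, saturated_bot⟩, 0, fun i => Fin.elim0 i, linearIndependent_empty_type, ?_, ?_, ?_⟩
  · rw [Set.range_eq_empty, AddSubgroup.closure_empty]
  · simp [ConnAlgSubgroup.addDim]
  · have h0 : nesterenkoH n 0 (ConnAlgSubgroup.addDim (⟨false, ⊥, saturated_bot⟩ : ConnAlgSubgroup n))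
        (fun i => Fin.elim0 i) D₀ D = 0 := by
      rw [show ConnAlgSubgroup.addDim (⟨false, ⊥, saturated_bot⟩ : ConnAlgSubgroup n) = 0 by
        simp [ConnAlgSubgroup.addDim]]
      exact nesterenkoH_zero_rank_eq_zero _ D₀ hD
    rw [h0, mul_zero]
    exact Nat.zero_le _

/-- **Prop. 5.1 when `D₀ = 0` and `n ≥ 1`**: the right-hand side is `0`, and `G* = 𝔾ₐ × T_{ℤe₁}`
(`d₀ = 1`, `r = 1`, dimension `n`) has `𝓗(G*; 0, D) = 0`. [cite: Nesterenko2003, Prop 5.1] -/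
theorem nesterenko2003_prop51_of_D₀_eq_zero (hn : 1 ≤ n) (S₀ : ℕ) (D : Fin n → ℕ)
    (W : Submodule ℂ (ℂ × (Fin n → ℂ))) (S : Set (GaGm n)) :
    ∃ (H : ConnAlgSubgroup n) (r : ℕ) (M : Matrix (Fin r) (Fin n) ℤ),
      LinearIndependent ℤ (fun i => M i) ∧
      H.chars = AddSubgroup.closure (Set.range fun i => M i) ∧
      H.addDim + (n - r) ≤ n ∧
      Nat.choose (S₀ + (Module.finrank ℂ W - Module.finrank ℂ ↥(W ⊓ H.tangent)))
          (Module.finrank ℂ W - Module.finrank ℂ ↥(W ⊓ H.tangent)) *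
        Set.ncard ((QuotientGroup.mk : GaGm n → GaGm n ⧸ H.toSubgroup) '' S) *
        nesterenkoH n r H.addDim M 0 D ≤ (n + 1).factorial * 2 ^ n * 0 * ∏ j, D j := by
  set j₀ : Fin n := ⟨0, hn⟩ with hj₀
  refine ⟨⟨true, AddSubgroup.zmultiples (Pi.single j₀ (1 : ℤ) : Fin n → ℤ), saturated_zmultiples_single j₀⟩, 1,
    fun _ => (Pi.single j₀ (1 : ℤ) : Fin n → ℤ), ?_, ?_, ?_, ?_⟩
  · rw [linearIndependent_unique_iff]
    intro h
    have := congrFun h j₀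
    simp at this
  · change AddSubgroup.zmultiples (Pi.single j₀ (1 : ℤ) : Fin n → ℤ) = _
    rw [AddSubgroup.zmultiples_eq_closure]
    congr 1
    ext χ
    simp
  · simp [ConnAlgSubgroup.addDim]; omega
  · have h0 : nesterenkoH n 1 (ConnAlgSubgroup.addDim
        (⟨true, AddSubgroup.zmultiples (Pi.single j₀ (1 : ℤ) : Fin n → ℤ), saturated_zmultiples_single j₀⟩ :
          ConnAlgSubgroup n))
        (fun _ => (Pi.single j₀ (1 : ℤ) : Fin n → ℤ)) 0 D = 0 := by
      rw [show ConnAlgSubgroup.addDim (⟨true, AddSubgroup.zmultiples (Pi.single j₀ (1 : ℤ) : Fin n → ℤ),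
        saturated_zmultiples_single j₀⟩ : ConnAlgSubgroup n) = 1 by simp [ConnAlgSubgroup.addDim]]
      exact nesterenkoH_addDim_one_D₀_zero _ D
    rw [h0, mul_zero]
    exact Nat.zero_le _

/-- **`n = 0`, `D₀ = 0` is contradictory**: a non-zero `Q ∈ ℂ[Y₀]` of degree `≤ 0` is a non-zero
constant and cannot vanish at `e`. [cite: Nesterenko2003, Prop 5.1] -/
theorem false_of_degreeOf_zero_of_vanishes {Q : MvPolynomial (Fin (0 + 1)) ℂ} (hQ0 : Q ≠ 0)
    (hdeg : Q.degreeOf 0 ≤ 0) {W : Submodule ℂ (ℂ × (Fin 0 → ℂ))} {N : ℕ} (hN : 1 ≤ N)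
    (hvan : VanishesToOrder Q W 1 N) : False := by
  have hC : Q = C (Q.coeff 0) := by
    refine eq_C_of_degreeOf_eq_zero fun i => ?_
    have : i = 0 := Fin.eq_zero i
    subst this
    exact Nat.le_zero.mp hdeg
  have h1 := (vanishesToOrder_one_iff Q W 1).mp (hvan.mono hN)
  rw [hC, evalAt_eq_eval, eval_C] at h1
  exact hQ0 (by rw [hC, h1, C_0])

end GaGm

end Literature.NumberTheory.Transcendental
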